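import Summits.ValiantsHypothesis.ValiantsHypothesis.Theorems.LacunarySymmetroidMatrixDescartesNsdPivotThreeFive
import Summits.ValiantsHypothesis.ValiantsHypothesis.Theorems.LacunarySymmetroidMatrixDescartesCensusPivotReverse
import Summits.ValiantsHypothesis.ValiantsHypothesis.Theorems.LacunarySymmetroidMatrixDescartesPencilEnds

/-!
# `MatrixDescartes` (stmt-ValiantsHypothesis-18050) — NSD pivot at `n = 2`: a RANK-ONE LONE LETTER COSTS ONE ROOT
# (`Z₊ ≤ 2K − 1` on the supports `(K−1 | 1)` and `(1 | K−1)`), and g11's five-object has EXACTLY five positive roots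

HONEST FRAMING.  Cell `pub-symmetroid`, seat `val-sym-mdr-p2` (gen 27); helper file `--supports` the crux
`Theses.LacunarySymmetroid.MatrixDescartes` (OPEN), NO closure claim.  A Descartes-level END LAW for the negative-semidefinite-pivot
column at `n = 2` (tree: `Pivot.DefinitePivot.pivotTwo_posRoots_le_two_mul_of_negSemidef_pivot`, `Z₊ ≤ 2K`, val-sym-mdr-p1 g6; sharp for
`K ≤ 4`, this seat gen 11), which explains in the kernel the «odd count» located by gen 11 (memo NSD-PIVOT-COLUMN.md §2, paper only):

* `card_posRoots_succ_le_two_mul_card` (polynomials): if every negative coefficient of `f` lies in `T`, and some `n₀ ∈ T` bounds the support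
  from above (`coeff n = 0` for `n > n₀`) with `coeff n₀ ≤ 0`, then `Z₊(f) + 1 ≤ 2·#T` — the top negative run cannot be left again.
* **`pivotPosRoots_succ_le_of_lone_above`**: a `2 × 2` pivot pencil `X^e J + ∑ₖ X^{dₖ} Pₖ` with `−J ⪰ 0`, `Pₖ ⪰ 0`, ONE letter `k₀` strictly
  above the pivot exponent, all other letters strictly below it, and `det P_{k₀} = 0` (rank `≤ 1`) has **`Z₊ + 1 ≤ 2K`**.  Reason: the top
  exponent of `det` is `e + d_{k₀}` (the exponent `2d_{k₀}` carries `det P_{k₀} = 0`, tree `PencilEnds.coeff_det_pencil_top/topNext`,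
  `lt_topNext_of_mem_support`) with coefficient `tr(adj P_{k₀} · J) ≤ 0` (`TrailingCoeffs.trace_adjugate_mul_nonneg`), while the negative
  coefficients sit among the `K` exponents `e + dₖ` (`WLawTwoSignCell.neg_coeff_cases`, `det J ≥ 0`).
* **`pivotPosRoots_succ_le_of_lone_below`**: the mirror `(1 | K−1)` by the reversal law `Pivot.Reverse.pivotPosRoots_reverse`.
* `K = 3`: **`NsdPivotThreeFive` IS EXACT** — `pivotPosRoots 1 ![2,0,21] J P = 5` for gen 11's object (`…NsdPivotThreeFive`, kernel sandwich
  was `5 ≤ Z₊ ≤ 6`; its lone lower letter `35·10⁷·(10,11)(10,11)ᵀ` is rank one), `nsd_loneBelow_rankOne_three_iff` (the row of this class at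
  `K = 3` is EXACTLY `5`), and the W-currency corollary `wNsd_two_le_five_of_rankOne_top` (a `2 × 2` W-pencil `X^e J + X^{d₁}P₁ + X^{d₂}P₂ + X^{d₃}Q`,
  `d₂ < d₁ < e < d₃`, with `J ⪯ 0` and `det Q = 0` has `Z₊ ≤ 5`; with a full-rank lone letter `6 = 2K` is attained, gen 11 `…NsdPivotThreeSix`,
  so the docstring question of `…NsdPivotThreeFive` «K = 3 ⇒ Z₊ ≤ 5?» is settled: YES for a rank-one lone letter, NO otherwise).
This is the NSD twin of the index-one RANK LADDER of gen 25 (`…PivotStaircaseBare/NoSlack`: bare `2K − 2` < lone full-rank corner `2K − 1` <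
both corners `2K`).  Nothing here bears on `MatrixDescartes` in its window, on `stub_twoSided`, on `DoorA26` / `DoorA34`, on the cell's
registers, or on `VP ≠ VNP`.

[folklore] Descartes' rule with a negative-support budget and one end (Mathlib `Polynomial.roots_countP_pos_le_signVariations`, tree
`Pivot.TwoDescartes.signVariations_add_le_two_mul_card_negSupp`); no definitions, no named facts.
-/

-- `Summit.ValiantsHypothesis.ValiantsHypothesis.…` repeats a component by the D-0017 layout
-- (single-conjunct summit), which the `dupNamespace` linter flags; the name is mandated.
set_option linter.dupNamespace false

namespace Summit.ValiantsHypothesis.ValiantsHypothesis.Theorems.LacunarySymmetroidMatrixDescartes.Pivot.NsdLoneRankOne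

open Matrix Finset Polynomial
open scoped BigOperators
open Pivot.TwoDescartes (letter expo pencil_eq_sum negSupp signVariations_add_le_two_mul_card_negSupp)

variable {K : ℕ}

/-! ## 1. Descartes with a negative-support budget and a non-positive top -/

/-- **Budget with one end.**  If every negative coefficient of `f` has its exponent in `T`, `n₀ ∈ T`, no exponent above `n₀` occurs in
`f`, and `coeff f n₀ ≤ 0`, then `Z₊(f) + 1 ≤ 2·#T` (if `coeff f n₀ < 0` it is the leading coefficient and the last sign run is negative;
if `coeff f n₀ = 0` the budget `T ∖ {n₀}` already suffices). [folklore] -/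
theorem card_posRoots_succ_le_two_mul_card (f : ℝ[X]) (T : Finset ℕ) (hT : ∀ n, f.coeff n < 0 → n ∈ T) {n₀ : ℕ}
    (hn₀ : n₀ ∈ T) (habove : ∀ n, n₀ < n → f.coeff n = 0) (hle : f.coeff n₀ ≤ 0) :
    (f.roots.toFinset.filter (fun t => 0 < t)).card + 1 ≤ 2 * T.card := by
  classical
  have h1 : (f.roots.toFinset.filter (fun t => 0 < t)).card ≤ f.roots.countP (fun t => 0 < t) := by
    rw [← Multiset.toFinset_filter, Multiset.countP_eq_card_filter]
    exact Multiset.toFinset_card_le _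
  have h2 := f.roots_countP_pos_le_signVariations
  have h3 := signVariations_add_le_two_mul_card_negSupp f
  have hsub : negSupp f ⊆ T := by
    intro n hn
    simp only [negSupp, Finset.mem_filter] at hn
    exact hT n hn.2
  by_cases hc : f.coeff n₀ < 0
  · have hcne : f.coeff n₀ ≠ 0 := hc.ne
    have hdeg : f.natDegree = n₀ :=
      le_antisymm ((Polynomial.natDegree_le_iff_coeff_eq_zero).mpr habove) (Polynomial.le_natDegree_of_ne_zero hcne)
    have hlc : f.leadingCoeff < 0 := by rw [Polynomial.leadingCoeff, hdeg]; exact hc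
    rw [if_pos hlc] at h3
    have h4 := Finset.card_le_card hsub
    omega
  · have hc0 : f.coeff n₀ = 0 := le_antisymm hle (not_lt.mp hc)
    have hsub' : negSupp f ⊆ T.erase n₀ := by
      intro n hn
      refine Finset.mem_erase.mpr ⟨?_, hsub hn⟩
      rintro rfl
      simp only [negSupp, Finset.mem_filter] at hn
      exact absurd hn.2 (by rw [hc0]; exact lt_irrefl 0)
    have h4 := Finset.card_le_card hsub'
    rw [Finset.card_erase_of_mem hn₀] at h4
    have h5 : 0 < T.card := Finset.card_pos.mpr ⟨n₀, hn₀⟩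
    have h6 : f.signVariations ≤ 2 * (negSupp f).card := le_trans (Nat.le_add_right _ _) h3
    omega

/-! ## 2. The pivot pencil with the pivot as letter `0` -/

/-- **Top coefficient.**  Lone letter `k₀` strictly above the pivot, all others strictly below: the coefficient of `X^{e + d k₀}` in
`det` is `tr(adj P_{k₀} · J)`. [folklore] -/
theorem coeff_det_top_eq (e : ℕ) (d : Fin K → ℕ) (J : Matrix (Fin 2) (Fin 2) ℝ) (P : Fin K → Matrix (Fin 2) (Fin 2) ℝ)
    (k₀ : Fin K) (htop : e < d k₀) (hlow : ∀ k, k ≠ k₀ → d k < e) :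
    (Matrix.det (((X : ℝ[X]) ^ e) • J.map Polynomial.C + ∑ k, ((X : ℝ[X]) ^ d k) • (P k).map Polynomial.C)).coeff (e + d k₀)
      = ((P k₀).adjugate * J).trace := by
  have h := PencilEnds.coeff_det_pencil_topNext (m := 1) (Fin.cons e d : Fin (K + 1) → ℕ)
    (Fin.cons J P : Fin (K + 1) → Matrix (Fin 2) (Fin 2) ℝ) (k₀ := k₀.succ) (k₁ := 0)
    (by simpa using htop)
    (by
      intro l hl0 hl1
      obtain ⟨k, rfl⟩ := Fin.eq_succ_of_ne_zero hl1
      have hk : k ≠ k₀ := fun h => hl0 (by rw [h])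
      simpa using hlow k hk)
  rw [Fin.sum_univ_succ] at h
  simp only [Fin.cons_succ, Fin.cons_zero, one_mul] at h
  rw [show e + d k₀ = d k₀ + e from Nat.add_comm _ _]
  convert h using 2

/-- **Nothing above.**  Same support hypotheses plus `det P_{k₀} = 0`: every coefficient above `e + d k₀` vanishes (the only candidate,
`2·d k₀`, carries `det P_{k₀}`). [folklore] -/
theorem coeff_det_eq_zero_of_lt (e : ℕ) (d : Fin K → ℕ) (J : Matrix (Fin 2) (Fin 2) ℝ) (P : Fin K → Matrix (Fin 2) (Fin 2) ℝ)
    (k₀ : Fin K) (htop : e < d k₀) (hlow : ∀ k, k ≠ k₀ → d k < e) (hrk : (P k₀).det = 0) {n : ℕ} (hn : e + d k₀ < n) :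
    (Matrix.det (((X : ℝ[X]) ^ e) • J.map Polynomial.C + ∑ k, ((X : ℝ[X]) ^ d k) • (P k).map Polynomial.C)).coeff n = 0 := by
  have h01 : (Fin.cons e d : Fin (K + 1) → ℕ) 0 < (Fin.cons e d : Fin (K + 1) → ℕ) k₀.succ := by simpa using htop
  have hnext : ∀ l : Fin (K + 1), l ≠ k₀.succ → l ≠ 0 →
      (Fin.cons e d : Fin (K + 1) → ℕ) l < (Fin.cons e d : Fin (K + 1) → ℕ) 0 := by
    intro l hl0 hl1
    obtain ⟨k, rfl⟩ := Fin.eq_succ_of_ne_zero hl1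
    have hk : k ≠ k₀ := fun h => hl0 (by rw [h])
    simpa using hlow k hk
  by_contra hne
  by_cases h2 : n = (1 + 1) * d k₀
  · have htopc := PencilEnds.coeff_det_pencil_top (m := 1) (Fin.cons e d : Fin (K + 1) → ℕ)
      (Fin.cons J P : Fin (K + 1) → Matrix (Fin 2) (Fin 2) ℝ) (k₀ := k₀.succ)
      (by
        intro l hl
        by_cases hl1 : l = 0
        · rw [hl1]; exact h01
        · exact (hnext l hl hl1).trans h01)
    rw [Fin.sum_univ_succ] at htopc
    simp only [Fin.cons_succ, Fin.cons_zero] at htopc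
    have htop' : (Matrix.det (((X : ℝ[X]) ^ e) • J.map Polynomial.C
        + ∑ k, ((X : ℝ[X]) ^ d k) • (P k).map Polynomial.C)).coeff ((1 + 1) * d k₀) = (P k₀).det := by
      convert htopc using 2
    apply hne
    rw [h2, htop', hrk]
  · have hmem : n ∈ (Matrix.det (∑ l : Fin (K + 1), ((X : ℝ[X]) ^ (Fin.cons e d : Fin (K + 1) → ℕ) l) •
        ((Fin.cons J P : Fin (K + 1) → Matrix (Fin (1 + 1)) (Fin (1 + 1)) ℝ) l).map Polynomial.C)).support := by
      rw [Polynomial.mem_support_iff, Fin.sum_univ_succ]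
      simp only [Fin.cons_succ, Fin.cons_zero]
      convert hne using 2
    have hlt := PencilEnds.lt_topNext_of_mem_support (m := 1) (Fin.cons e d : Fin (K + 1) → ℕ)
      (Fin.cons J P : Fin (K + 1) → Matrix (Fin (1 + 1)) (Fin (1 + 1)) ℝ) h01 hnext hmem (by simpa using h2)
      (by simp only [Fin.cons_succ, Fin.cons_zero]; omega)
    simp only [Fin.cons_succ, Fin.cons_zero] at hlt
    omega

/-! ## 3. The lone rank-one letter costs one root -/

/-- **`(K−1 | 1)` with a rank-one lone letter: `Z₊ + 1 ≤ 2K`.**  A `2 × 2` pivot pencil `X^e J + ∑ₖ X^{dₖ} Pₖ` with `−J ⪰ 0`, all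
`Pₖ ⪰ 0`, one letter `k₀` strictly above the pivot exponent, all other letters strictly below it, and `det P_{k₀} = 0` has at most
`2K − 1` distinct positive determinant roots. [folklore] -/
theorem pivotPosRoots_succ_le_of_lone_above (e : ℕ) (d : Fin K → ℕ) (J : Matrix (Fin 2) (Fin 2) ℝ)
    (P : Fin K → Matrix (Fin 2) (Fin 2) ℝ) (hJ : (-J).PosSemidef) (hP : ∀ k, (P k).PosSemidef) (k₀ : Fin K)
    (htop : e < d k₀) (hlow : ∀ k, k ≠ k₀ → d k < e) (hrk : (P k₀).det = 0) :
    pivotPosRoots e d J P + 1 ≤ 2 * K := by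
  classical
  unfold pivotPosRoots
  set T : Finset ℕ := (Finset.univ : Finset (Fin K)).image (fun k => e + d k) with hT
  have hTcard : T.card ≤ K := le_trans Finset.card_image_le (by simp)
  have hn₀ : e + d k₀ ∈ T := Finset.mem_image.mpr ⟨k₀, Finset.mem_univ _, rfl⟩
  have hd : ∀ k, d k ≠ e := by
    intro k
    by_cases hk : k = k₀
    · rw [hk]; exact htop.ne'
    · exact (hlow k hk).ne
  have hdetJ : 0 ≤ J.det := by
    have h := hJ.det_nonneg
    rwa [Matrix.det_neg, Fintype.card_fin, show ((-1 : ℝ) ^ 2) = 1 by norm_num, one_mul] at h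
  -- negative coefficients sit at the `e + dₖ`
  have hneg : ∀ n, (Matrix.det (((X : ℝ[X]) ^ e) • J.map Polynomial.C
      + ∑ k, ((X : ℝ[X]) ^ d k) • (P k).map Polynomial.C)).coeff n < 0 → n ∈ T := by
    intro n hn
    rw [pencil_eq_sum] at hn
    rcases WLawTwoSignCell.neg_coeff_cases e d J P hP hd n hn with ⟨_, hJlt⟩ | ⟨k, hnk, _⟩
    · exact absurd hdetJ (not_le.mpr hJlt)
    · exact Finset.mem_image.mpr ⟨k, Finset.mem_univ _, hnk.symm⟩
  -- the top coefficient `tr(adj P_{k₀} · J) ≤ 0`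
  have hle : (Matrix.det (((X : ℝ[X]) ^ e) • J.map Polynomial.C
      + ∑ k, ((X : ℝ[X]) ^ d k) • (P k).map Polynomial.C)).coeff (e + d k₀) ≤ 0 := by
    rw [coeff_det_top_eq e d J P k₀ htop hlow]
    have h := TrailingCoeffs.trace_adjugate_mul_nonneg (hP k₀) hJ
    rw [Matrix.mul_neg, Matrix.trace_neg] at h
    linarith
  have h := card_posRoots_succ_le_two_mul_card _ T hneg hn₀
    (fun n hn => coeff_det_eq_zero_of_lt e d J P k₀ htop hlow hrk hn) hle
  omega

/-- **`(1 | K−1)` with a rank-one lone letter: `Z₊ + 1 ≤ 2K`** (mirror of `pivotPosRoots_succ_le_of_lone_above` under `x ↦ 1/x`,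
tree `Pivot.Reverse.pivotPosRoots_reverse`): one letter `k₀` strictly BELOW the pivot exponent with `det P_{k₀} = 0`, all other letters
strictly above. [folklore] -/
theorem pivotPosRoots_succ_le_of_lone_below (e : ℕ) (d : Fin K → ℕ) (J : Matrix (Fin 2) (Fin 2) ℝ)
    (P : Fin K → Matrix (Fin 2) (Fin 2) ℝ) (hJ : (-J).PosSemidef) (hP : ∀ k, (P k).PosSemidef) (k₀ : Fin K)
    (hbot : d k₀ < e) (hup : ∀ k, k ≠ k₀ → e < d k) (hrk : (P k₀).det = 0) :
    pivotPosRoots e d J P + 1 ≤ 2 * K := by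
  classical
  -- reverse all exponents about a common bound `N`
  set N : ℕ := e + ∑ k, d k with hN
  have he : e ≤ N := by rw [hN]; exact Nat.le_add_right _ _
  have hdN : ∀ k, d k ≤ N := fun k => by
    rw [hN]
    exact (Finset.single_le_sum (fun i _ => Nat.zero_le (d i)) (Finset.mem_univ k)).trans (Nat.le_add_left _ _)
  rw [← Reverse.pivotPosRoots_reverse N e d J P he hdN]
  refine pivotPosRoots_succ_le_of_lone_above (N - e) (fun k => N - d k) J P hJ hP k₀ ?_ ?_ hrk
  · have := hdN k₀; omega
  · intro k hk
    have := hup k hk; have := hdN k; omega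

/-! ## 4. `K = 3`: gen 11's five-object is exact; the W-currency corollary -/

/-- The lone lower letter `35·10⁷·(10,11)(10,11)ᵀ` of `…NsdPivotThreeFive` is rank one. [folklore] -/
theorem threeFive_lone_det :
    ((![!![(5000000000 : ℝ), (15000000000 : ℝ); (15000000000 : ℝ), (45000000000 : ℝ)],
        !![(35000000000 : ℝ), (38500000000 : ℝ); (38500000000 : ℝ), (42350000000 : ℝ)],
        !![(3 : ℝ), (12 : ℝ); (12 : ℝ), (48 : ℝ)]] : Fin 3 → Matrix (Fin 2) (Fin 2) ℝ) 1).det = 0 := by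
  simp [Matrix.det_fin_two]
  norm_num

/-- **THE FIVE IS EXACT.**  Gen 11's `K = 3` object (pivot `−5·10⁹·1` at exponent `1`, rank-one letters at `2, 0, 21`; kernel sandwich
`5 ≤ Z₊ ≤ 6` in `…NsdPivotThreeFive`) has EXACTLY five distinct positive determinant roots: its lone lower letter is rank one. [folklore] -/
theorem threeFive_pivotPosRoots_eq_five :
    pivotPosRoots 1 (![2, 0, 21] : Fin 3 → ℕ) (!![((-5000000000) : ℝ), 0; 0, ((-5000000000) : ℝ)] : Matrix (Fin 2) (Fin 2) ℝ)
      (![!![(5000000000 : ℝ), (15000000000 : ℝ); (15000000000 : ℝ), (45000000000 : ℝ)],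
         !![(35000000000 : ℝ), (38500000000 : ℝ); (38500000000 : ℝ), (42350000000 : ℝ)],
         !![(3 : ℝ), (12 : ℝ); (12 : ℝ), (48 : ℝ)]] : Fin 3 → Matrix (Fin 2) (Fin 2) ℝ) = 5 := by
  refine le_antisymm ?_ NsdPivotThreeFive.five_le_pivotPosRoots
  have h := pivotPosRoots_succ_le_of_lone_below 1 (![2, 0, 21] : Fin 3 → ℕ) _ _ NsdPivotThreeFive.neg_J_posSemidef
    NsdPivotThreeFive.P_posSemidef 1 (by simp) (by intro k hk; fin_cases k <;> simp_all) threeFive_lone_det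
  omega

/-- **The `(1 | 2)` NSD row with a rank-one lone letter is EXACTLY `5` (`K = 3`).**  A budget `B` is valid for every `2 × 2` pivot pencil
with `−J ⪰ 0`, three PSD letters of which exactly one — of rank `≤ 1` — lies strictly below the pivot and two strictly above, iff `5 ≤ B`.
(With a FULL-RANK lone letter the row is `6 = 2K`: `…NsdPivotThreeSix`.) [folklore] -/
theorem nsd_loneBelow_rankOne_three_iff (B : ℕ) :
    (∀ (e : ℕ) (d : Fin 3 → ℕ) (J : Matrix (Fin 2) (Fin 2) ℝ) (P : Fin 3 → Matrix (Fin 2) (Fin 2) ℝ) (k₀ : Fin 3),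
        (-J).PosSemidef → (∀ k, (P k).PosSemidef) → d k₀ < e → (∀ k, k ≠ k₀ → e < d k) → (P k₀).det = 0 →
        pivotPosRoots e d J P ≤ B) ↔ 5 ≤ B := by
  constructor
  · intro h
    rw [← threeFive_pivotPosRoots_eq_five]
    exact h 1 _ _ _ 1 NsdPivotThreeFive.neg_J_posSemidef NsdPivotThreeFive.P_posSemidef (by simp)
      (by intro k hk; fin_cases k <;> simp_all) threeFive_lone_det
  · intro hB e d J P k₀ hJ hP hbot hup hrk
    have := pivotPosRoots_succ_le_of_lone_below e d J P hJ hP k₀ hbot hup hrk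
    omega

/-- **W-currency corollary (the `(2 | 1)` shape of `…WLawDefs`).**  A `2 × 2` W-pencil `X^e J + X^{d₁}P₁ + X^{d₂}P₂ + X^{d₃}Q` with
`d₂ < d₁ < e < d₃`, NEGATIVE-SEMIDEFINITE pivot `J` and PSD letters whose top letter `Q` has rank `≤ 1` (`det Q = 0`) has at most FIVE
distinct positive determinant roots (the graded ceiling of the NSD row at `n = 2` is `6`, tree `Pivot.DefiniteGraded.wNsd_le`, attained only
with a full-rank lone letter). [folklore] -/
theorem wNsd_two_le_five_of_rankOne_top (e d₁ d₂ d₃ : ℕ) (J P₁ P₂ Q : Matrix (Fin 2) (Fin 2) ℝ) (hJ : (-J).PosSemidef)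
    (hP₁ : P₁.PosSemidef) (hP₂ : P₂.PosSemidef) (hQ : Q.PosSemidef) (h21 : d₂ < d₁) (h1e : d₁ < e) (he3 : e < d₃)
    (hrk : Q.det = 0) :
    ((Matrix.det (((X : ℝ[X]) ^ e) • J.map Polynomial.C
        + ((X : ℝ[X]) ^ d₁) • P₁.map Polynomial.C + ((X : ℝ[X]) ^ d₂) • P₂.map Polynomial.C
        + ((X : ℝ[X]) ^ d₃) • Q.map Polynomial.C)).roots.toFinset.filter (fun t => 0 < t)).card ≤ 5 := by
  have hP : ∀ k : Fin 3, ((![P₁, P₂, Q] : Fin 3 → Matrix (Fin 2) (Fin 2) ℝ) k).PosSemidef := by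
    intro k; fin_cases k <;> assumption
  have h := pivotPosRoots_succ_le_of_lone_above e (![d₁, d₂, d₃] : Fin 3 → ℕ) J ![P₁, P₂, Q] hJ hP 2 (by simpa using he3)
    (by intro k hk; fin_cases k <;> simp_all; omega) (by simpa using hrk)
  unfold pivotPosRoots at h
  have hsum : ((X : ℝ[X]) ^ e) • J.map Polynomial.C
        + ((X : ℝ[X]) ^ d₁) • P₁.map Polynomial.C + ((X : ℝ[X]) ^ d₂) • P₂.map Polynomial.C
        + ((X : ℝ[X]) ^ d₃) • Q.map Polynomial.C
      = ((X : ℝ[X]) ^ e) • J.map Polynomial.C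
        + ∑ k : Fin 3, ((X : ℝ[X]) ^ (![d₁, d₂, d₃] : Fin 3 → ℕ) k) •
          ((![P₁, P₂, Q] : Fin 3 → Matrix (Fin 2) (Fin 2) ℝ) k).map Polynomial.C := by
    rw [Fin.sum_univ_three]
    simp only [Matrix.cons_val_zero, Matrix.cons_val_one, Matrix.cons_val_two, Matrix.head_cons, Matrix.tail_cons]
    abel
  rw [hsum]
  exact Nat.le_of_lt_succ (Nat.lt_of_succ_le h)

/-- The reflected five-object (`x ↦ 1/x`, `N = 21`): pivot at `20`, letters at `19, 21, 0` — a W-shape `(2 | 1)` whose lone UPPER letter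
(at `21`) is the rank-one `35·10⁷·(10,11)(10,11)ᵀ`; it has exactly five positive roots (`Pivot.Reverse.pivotPosRoots_reverse`). [folklore] -/
theorem threeFive_reflected_eq_five :
    pivotPosRoots 20 (![19, 21, 0] : Fin 3 → ℕ) (!![((-5000000000) : ℝ), 0; 0, ((-5000000000) : ℝ)] : Matrix (Fin 2) (Fin 2) ℝ)
      (![!![(5000000000 : ℝ), (15000000000 : ℝ); (15000000000 : ℝ), (45000000000 : ℝ)],
         !![(35000000000 : ℝ), (38500000000 : ℝ); (38500000000 : ℝ), (42350000000 : ℝ)],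
         !![(3 : ℝ), (12 : ℝ); (12 : ℝ), (48 : ℝ)]] : Fin 3 → Matrix (Fin 2) (Fin 2) ℝ) = 5 := by
  have h := Reverse.pivotPosRoots_reverse 21 1 (![2, 0, 21] : Fin 3 → ℕ)
    (!![((-5000000000) : ℝ), 0; 0, ((-5000000000) : ℝ)] : Matrix (Fin 2) (Fin 2) ℝ)
    (![!![(5000000000 : ℝ), (15000000000 : ℝ); (15000000000 : ℝ), (45000000000 : ℝ)],
       !![(35000000000 : ℝ), (38500000000 : ℝ); (38500000000 : ℝ), (42350000000 : ℝ)],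
       !![(3 : ℝ), (12 : ℝ); (12 : ℝ), (48 : ℝ)]] : Fin 3 → Matrix (Fin 2) (Fin 2) ℝ)
    (by norm_num) (by intro k; fin_cases k <;> simp)
  rw [threeFive_pivotPosRoots_eq_five] at h
  have hd : (fun k => 21 - (![2, 0, 21] : Fin 3 → ℕ) k) = (![19, 21, 0] : Fin 3 → ℕ) := by
    funext k; fin_cases k <;> rfl
  rw [hd] at h
  exact h

/-- **The NSD W-row at `n = 2` with a rank-one top letter is EXACTLY `5`.**  A budget `B` is valid for every `2 × 2` W-pencil
`X^e J + X^{d₁}P₁ + X^{d₂}P₂ + X^{d₃}Q` (`d₂ < d₁ < e < d₃`, `J ⪯ 0`, `P₁, P₂, Q ⪰ 0`, `det Q = 0`) iff `5 ≤ B` (upper side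
`wNsd_two_le_five_of_rankOne_top`; the reflected five-object of gen 11 attains `5`).  Without the rank condition the row is `6`
(`…NsdPivotThreeSix`, `Pivot.DefiniteGraded.wNsd_le`). [folklore] -/
theorem wNsd_two_rankOne_top_iff (B : ℕ) :
    (∀ (e d₁ d₂ d₃ : ℕ) (J P₁ P₂ Q : Matrix (Fin 2) (Fin 2) ℝ), (-J).PosSemidef → P₁.PosSemidef → P₂.PosSemidef → Q.PosSemidef →
        d₂ < d₁ → d₁ < e → e < d₃ → Q.det = 0 →
        ((Matrix.det (((X : ℝ[X]) ^ e) • J.map Polynomial.C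
            + ((X : ℝ[X]) ^ d₁) • P₁.map Polynomial.C + ((X : ℝ[X]) ^ d₂) • P₂.map Polynomial.C
            + ((X : ℝ[X]) ^ d₃) • Q.map Polynomial.C)).roots.toFinset.filter (fun t => 0 < t)).card ≤ B) ↔ 5 ≤ B := by
  constructor
  · intro h
    have hP := NsdPivotThreeFive.P_posSemidef
    have h5 := h 20 19 0 21 (!![((-5000000000) : ℝ), 0; 0, ((-5000000000) : ℝ)] : Matrix (Fin 2) (Fin 2) ℝ)
      (!![(5000000000 : ℝ), (15000000000 : ℝ); (15000000000 : ℝ), (45000000000 : ℝ)])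
      (!![(3 : ℝ), (12 : ℝ); (12 : ℝ), (48 : ℝ)])
      (!![(35000000000 : ℝ), (38500000000 : ℝ); (38500000000 : ℝ), (42350000000 : ℝ)])
      NsdPivotThreeFive.neg_J_posSemidef (by simpa using hP 0) (by simpa using hP 2) (by simpa using hP 1)
      (by norm_num) (by norm_num) (by norm_num) (by simpa using threeFive_lone_det)
    have hW := threeFive_reflected_eq_five
    unfold pivotPosRoots at hW
    have hsum : ((X : ℝ[X]) ^ 20) • (!![((-5000000000) : ℝ), 0; 0, ((-5000000000) : ℝ)] : Matrix (Fin 2) (Fin 2) ℝ).map Polynomial.C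
        + ((X : ℝ[X]) ^ 19) • (!![(5000000000 : ℝ), (15000000000 : ℝ); (15000000000 : ℝ), (45000000000 : ℝ)]
            : Matrix (Fin 2) (Fin 2) ℝ).map Polynomial.C
        + ((X : ℝ[X]) ^ 0) • (!![(3 : ℝ), (12 : ℝ); (12 : ℝ), (48 : ℝ)] : Matrix (Fin 2) (Fin 2) ℝ).map Polynomial.C
        + ((X : ℝ[X]) ^ 21) • (!![(35000000000 : ℝ), (38500000000 : ℝ); (38500000000 : ℝ), (42350000000 : ℝ)]
            : Matrix (Fin 2) (Fin 2) ℝ).map Polynomial.C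
      = ((X : ℝ[X]) ^ 20) • (!![((-5000000000) : ℝ), 0; 0, ((-5000000000) : ℝ)] : Matrix (Fin 2) (Fin 2) ℝ).map Polynomial.C
        + ∑ k : Fin 3, ((X : ℝ[X]) ^ (![19, 21, 0] : Fin 3 → ℕ) k) •
          ((![!![(5000000000 : ℝ), (15000000000 : ℝ); (15000000000 : ℝ), (45000000000 : ℝ)],
              !![(35000000000 : ℝ), (38500000000 : ℝ); (38500000000 : ℝ), (42350000000 : ℝ)],
              !![(3 : ℝ), (12 : ℝ); (12 : ℝ), (48 : ℝ)]] : Fin 3 → Matrix (Fin 2) (Fin 2) ℝ) k).map Polynomial.C := by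
      rw [Fin.sum_univ_three]
      simp only [Matrix.cons_val_zero, Matrix.cons_val_one, Matrix.cons_val_two, Matrix.head_cons, Matrix.tail_cons]
      abel
    rw [hsum] at h5
    rw [hW] at h5
    exact h5
  · intro hB e d₁ d₂ d₃ J P₁ P₂ Q hJ hP₁ hP₂ hQ h21 h1e he3 hrk
    exact (wNsd_two_le_five_of_rankOne_top e d₁ d₂ d₃ J P₁ P₂ Q hJ hP₁ hP₂ hQ h21 h1e he3 hrk).trans hB

end Summit.ValiantsHypothesis.ValiantsHypothesis.Theorems.LacunarySymmetroidMatrixDescartes.Pivot.NsdLoneRankOne
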